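import Literature.NumberTheory.NumberFields.ImaginaryAbelianFieldOddChiClassNumber
import Literature.NumberTheory.LFunctions.GeneralizedBernoulliOneOddNonvanishingAnyField
import HarnessLib

/-!
# The Mazur–Wiles direction «`p ∣ B_{1,χ⁻¹}` ⟹ `(Cℓ(K) ⊗ ℤ_p)^χ ≠ 0`» WITHOUT the side condition
# `B_{1,χ⁻¹} ≠ 0`

Topic `Literature/NumberTheory/NumberFields`. ONE THEOREM (no definition, no named fact, no `sorry`).

The tree's reading of Mazur–Wiles 1984 Thm. 2 (`ImaginaryAbelianFieldOddChiClassNumber`,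
`classGroupChiComponent_ne_bot_of_norm_bernoulli_lt_one`: under the theorem, for an odd primitive
non-Teichmüller `χ` with `‖B_{1,χ⁻¹}‖_p < 1`, the `χ`-eigenspace of `ℤ_p ⊗ Cl(K)` is non-zero) carries
the hypothesis `hB0 : bernoulliOnePrim χ⁻¹ ≠ 0` (with `B = 0` the typed identity `#e_ψ = ‖B‖⁻¹`
degenerates). That hypothesis is a THEOREM for odd `χ` (Washington Cor. 4.4, transferred to
`ℚ_p`-valued characters in `LFunctions.bernoulliOnePrim_inv_ne_zero_of_odd`); this file records the
reading with it discharged — the root of the Birch–Swinnerton-Dyer `PrintCFram` level-dictionary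
(β) chain. Conditional on Mazur–Wiles Thm. 2 (`h`) only.
-/

noncomputable section

open NumberField Field
open Literature.NumberTheory.GaloisRepresentations Literature.NumberTheory.EllipticCurves
open Literature.RepresentationTheory.FiniteGroups

namespace Literature.NumberTheory.NumberFields

variable {p : ℕ} [Fact p.Prime]
variable {K : Type} [Field K] [NumberField K]

/-- **The Mazur–Wiles direction (converse of Herbrand): `p ∣ B_{1,χ⁻¹} ⟹ (Cℓ(K) ⊗ ℤ_p)^χ ≠ 0`, with
NO `B_{1,χ⁻¹} ≠ 0` side condition.** For `p ≠ 2`, `K/ℚ` abelian with `p ∤ [K : ℚ]`, `χ` an odd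
primitive `ℚ_p`-valued Dirichlet character, not Teichmüller-congruent, with Galois avatar `ψ` on
`Gal(K/ℚ)`, and `‖B_{1,χ⁻¹}‖_p < 1`: granted Mazur–Wiles Thm. 2, `e_ψ(ℤ_p ⊗ Cl(K)) ≠ ⊥`. The tree's
`classGroupChiComponent_ne_bot_of_norm_bernoulli_lt_one` with `hB0` supplied by
`LFunctions.bernoulliOnePrim_inv_ne_zero_of_odd` (`χ` odd ⟹ `B_{1,(χ⁻¹)~} ≠ 0`).
[cite: MazurWiles1984, Thm. 2 (p. 216) — via Solomon1990, §I p. 468; Washington1997, Cor. 4.4] -/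
theorem classGroupChiComponent_ne_bot_of_odd_of_norm_bernoulli_lt_one
    (h : MazurWiles1984.thm2_card_oddChiClassGroup_eq_bernoulli) (hp2 : p ≠ 2)
    [IsAbelianGalois ℚ K] (hpK : ¬ p ∣ Module.finrank ℚ K)
    {f : ℕ} [NeZero f] {χ : DirichletCharacter ℚ_[p] f} (hprim : χ.IsPrimitive) (hodd : χ.Odd)
    (hχω : ¬ ∀ a : ℤ, ¬ ((p : ℤ) ∣ a) → ‖χ (a : ZMod f) - (a : ℚ_[p])‖ < 1)
    {ψ : (K ≃ₐ[ℚ] K) →* ℤ_[p]ˣ}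
    (hψχ : ∀ τ : absoluteGaloisGroup ℚ,
      (((ψ (absGaloisQuot ℚ K τ) : ℤ_[p]ˣ) : ℤ_[p]) : ℚ_[p]) =
        χ ((modNCyclotomicCharacter ℚ f τ : (ZMod f)ˣ) : ZMod f))
    (hB : ‖KrizLi2019.bernoulliOnePrim χ⁻¹‖ < 1) :
    classGroupChiComponent ℚ K p (fun σ => ((ψ σ : ℤ_[p]ˣ) : ℤ_[p])) ≠ ⊥ :=
  classGroupChiComponent_ne_bot_of_norm_bernoulli_lt_one h hp2 hpK hprim hodd hχω hψχ
    (LFunctions.bernoulliOnePrim_inv_ne_zero_of_odd χ hodd) hB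

end Literature.NumberTheory.NumberFields

end
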